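import Mathlib.LinearAlgebra.Matrix.Determinant.Basic
import Literature.NumberTheory.EllipticCurves.Heights
import Literature.NumberTheory.EllipticCurves.BSDInvariants
import Literature.NumberTheory.EllipticCurves.AnalyticRank
import HarnessLib

/-!
# Named fact: the rank-one Gross–Zagier datum over `ℚ`

Grounder file (D-0014 named facts) for the route `BirchSwinnertonDyer/HigherGrossZagier`,
statement item stmt-BirchSwinnertonDyer-0148 (`higherGZ_rankOne`): the `r = 1` instance of the
route's posited "rank-`r` Gross–Zagier datum" is a theorem in print.

Let `E/ℚ` be an elliptic curve (modular by Wiles / Breuil–Conrad–Diamond–Taylor) with analytic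
rank `1`. Choose an imaginary quadratic field `K` satisfying the Heegner hypothesis for the
conductor of `E` with `L(E^{D}, 1) ≠ 0` for the associated quadratic twist (possible by
Bump–Friedberg–Hoffstein 1990 / Murty–Murty 1991, since the sign of `E^D` is `+1` when that of `E`
is `−1`). Gross–Zagier (Invent. Math. 84 (1986), Thm. I.6.3, and §V.2 for the descent to `ℚ`)
gives `L'(E/K, 1) = L'(E,1) L(E^D,1) = c_K · ĥ(P_K)` with an explicit `c_K > 0` and the Heegner
point `P_K ∈ E(K)`; taking the trace `P ∈ E(ℚ)` (non-torsion since `L'(E,1) ≠ 0`, and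
`ĥ(P) = 2 ĥ_K(P_K)`-type comparison up to a positive rational) and using `L(E^D,1) > 0`
(non-negativity of central twisted values, Waldspurger 1981 / Kohnen–Zagier / Gross–Zagier), one
gets `L'(E, 1) = c · ĥ(P)` for some real `c > 0`. Here `leadingLCoeff = L^{(r)}(E,1)/r! = L'(E,1)`
for `r = 1` and `canonicalHeight` is the tree's Néron–Tate height (any positive normalisation is
absorbed by `c`).

Nothing is asserted; users take `(h : WeierstrassCurve.gross_zagier_rank_one_rat)`.

## References

* B. Gross, D. Zagier, *Heegner points and derivatives of `L`-series*, Invent. Math. 84 (1986),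
  225–320, Thm. I.6.3, §V.2.
* D. Bump, S. Friedberg, J. Hoffstein, Invent. Math. 102 (1990); M. R. Murty, V. K. Murty,
  Ann. of Math. 133 (1991) (non-vanishing quadratic twists).
* V. Kolyvagin, *Euler systems* (1990) (not needed for the identity, gives `rank E(ℚ) = 1`).
-/

noncomputable section

namespace WeierstrassCurve

/-- NAMED FACT (rank-one Gross–Zagier over `ℚ`; Gross–Zagier 1986 Thm. I.6.3 with §V.2, and a
non-vanishing twist from Bump–Friedberg–Hoffstein 1990 / Murty–Murty 1991). If `E/ℚ` has analytic
rank `1` then there are a rational point `P` and a real `c > 0` with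
`L'(E,1) (= leadingLCoeff) = c · ĥ(P)`. Users take `(h : gross_zagier_rank_one_rat)`. [cite: GrossZagier1986, Thm. I.6.3 and §V.2] -/
def gross_zagier_rank_one_rat : Prop :=
  ∀ (W : WeierstrassCurve ℚ) [W.IsElliptic], W.analyticRank = 1 →
    ∃ (P : W.toAffine.Point) (c : ℝ), 0 < c ∧ W.leadingLCoeff = ((c * P.canonicalHeight : ℝ) : ℂ)

end WeierstrassCurve

end
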